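import Literature.Combinatorics.StablePolynomials.NegativeCorrelation
import HarnessLib

/-!
# Void (emptiness) probabilities under real stable multi-affine coefficient families

Topic `Literature/Combinatorics/StablePolynomials`; companion of `NegativeCorrelation.lean`.
For a NONNEGATIVE real coefficient family `c` (an unnormalised measure on subsets of `σ`) whose
generating polynomial is identically zero or zero-free on `H^σ` (strongly Rayleigh up to
normalisation), and a finite set `B ⊆ σ`:

* `multiAffine_stableOrZero_restrictVoid` — conditioning on `S ∩ B = ∅` (specialising `z_j := 0`,
  `j ∈ B`) keeps "stable or zero";
* `multiAffine_inclusion_mono_void` — **emptiness raises inclusion probabilities**: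
  `P(b ∈ S | S ∩ B = ∅) ≥ P(b ∈ S)` for `b ∉ B` (cross-multiplied), by induction on `B` from
  pairwise negative correlation in the conditioned families;
* `multiAffine_void_le_prod` — `P(S ∩ B = ∅) ≤ ∏_{b∈B} (1 - P(b ∈ S))`;
* `multiAffine_void_le_exp` — `P(S ∩ B = ∅) ≤ exp(-Σ_{b∈B} P(b ∈ S))` (expected number of points
  in `B`).

These are the standard "negative dependence ⇒ sub-Poissonian emptiness" bounds
(Borcea–Brändén–Liggett 2009, §4.1, consequences of the strong Rayleigh property), obtained here
WITHOUT the negative-association theorem: only pairwise negative correlation and stability of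
conditioning are used. Written for the amplitude-LINEAR void tail of crux
`BECStronglyRayleigh.InsertionFieldDelocalisation` (stmt-AtomisticToContinuum-9673; the Born-rule,
quadratic, analogue is the open "measure knot"), stated in full generality.

## Mathlib / tree search

REUSED: `multiAffine_stableOrZero_specialize`, `multiAffine_pairwise_negCorr` (tree, companion
file); Mathlib `Finset.induction_on`, `Real.add_one_le_exp`, `Real.exp_sum`, `Finset.prod_le_prod`.
-/

noncomputable section

namespace Literature.Combinatorics.StablePolynomials

open MvPolynomial Finset Filter Topology
open scoped BigOperators

variable {σ : Type*} [Fintype σ] [DecidableEq σ]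

/-- **Conditioning on emptiness keeps "stable or zero"**: restricting a real coefficient family
to the sets avoiding a finite set `B` (i.e. setting `z_j := 0` for `j ∈ B`) preserves
"identically zero or zero-free on `H^σ`". [cite: Wagner2011, Lemma 2.4 (d)] -/
theorem multiAffine_stableOrZero_restrictVoid (c : Finset σ → ℝ)
    (hc : (∀ S, c S = 0) ∨
      ∀ z : σ → ℂ, (∀ i, 0 < (z i).im) → (∑ S : Finset σ, (c S : ℂ) * ∏ i ∈ S, z i) ≠ 0)
    (B : Finset σ) :
    (∀ S, (if Disjoint B S then c S else 0) = 0) ∨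
      ∀ z : σ → ℂ, (∀ i, 0 < (z i).im) →
        (∑ S : Finset σ, ((if Disjoint B S then c S else 0 : ℝ) : ℂ) * ∏ i ∈ S, z i) ≠ 0 := by
  classical
  induction B using Finset.induction_on with
  | empty => simpa using hc
  | insert j B hjB ih =>
    have h := multiAffine_stableOrZero_specialize (fun S => if Disjoint B S then c S else 0) ih j 0
    simp only [zero_mul, add_zero] at h
    have hfam : ∀ S : Finset σ, (if j ∈ S then (0 : ℝ) else if Disjoint B S then c S else 0) =
        if Disjoint (insert j B) S then c S else 0 := by
      intro S
      by_cases hjS : j ∈ S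
      · rw [if_pos hjS, if_neg]
        exact fun hd => Finset.disjoint_left.1 hd (Finset.mem_insert_self j B) hjS
      · rw [if_neg hjS]
        by_cases hd : Disjoint B S
        · rw [if_pos hd, if_pos (Finset.disjoint_insert_left.2 ⟨hjS, hd⟩)]
        · rw [if_neg hd, if_neg]
          exact fun h => hd (Finset.disjoint_of_subset_left (Finset.subset_insert j B) h)
    simp only [hfam] at h
    exact h

/-- **Emptiness raises inclusion probabilities** (negative dependence, conditional form): for a
NONNEGATIVE real family that is identically zero or zero-free on `H^σ`, a finite set `B` and a
site `b ∉ B`, `P(b ∈ S | S ∩ B = ∅) ≥ P(b ∈ S)`, in cross-multiplied form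
`(Σ_{S ∋ b, S ∩ B = ∅} c)·(Σ_S c) ≥ (Σ_{S ∋ b} c)·(Σ_{S ∩ B = ∅} c)` (induction on `B` with
pairwise negative correlation in the conditioned families). [cite: BorceaBrandenLiggett2007, §4.1] -/
theorem multiAffine_inclusion_mono_void (c : Finset σ → ℝ) (hc0 : ∀ S, 0 ≤ c S)
    (hc : (∀ S, c S = 0) ∨
      ∀ z : σ → ℂ, (∀ i, 0 < (z i).im) → (∑ S : Finset σ, (c S : ℂ) * ∏ i ∈ S, z i) ≠ 0)
    (B : Finset σ) {b : σ} (hb : b ∉ B) :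
    (∑ S ∈ univ.filter (fun S : Finset σ => b ∈ S), c S) *
        (∑ S ∈ univ.filter (fun S : Finset σ => Disjoint B S), c S) ≤
      (∑ S ∈ univ.filter (fun S : Finset σ => b ∈ S ∧ Disjoint B S), c S) * (∑ S, c S) := by
  classical
  induction B using Finset.induction_on with
  | empty =>
    simp only [Finset.disjoint_empty_left, and_true]
    rw [Finset.filter_true_of_mem (fun _ _ => trivial), mul_comm]
  | insert j B hjB ih =>
    have hbj : b ≠ j := fun h => hb (h ▸ Finset.mem_insert_self j B)
    have hbB : b ∉ B := fun h => hb (Finset.mem_insert_of_mem h)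
    have ih' := ih hbB
    -- the family conditioned on `S ∩ B = ∅`
    set c' : Finset σ → ℝ := fun S => if Disjoint B S then c S else 0 with hc'
    have hc'0 : ∀ S, 0 ≤ c' S := fun S => by
      simp only [hc']
      split_ifs
      · exact hc0 S
      · exact le_rfl
    have hst' := multiAffine_stableOrZero_restrictVoid c hc B
    -- pairwise negative correlation of `b` and `j` under `c'`
    have hnc := multiAffine_pairwise_negCorr c' hst' hbj
    -- dictionary between `c'`-sums and `c`-sums
    have dsum : ∀ (p : Finset σ → Prop) [DecidablePred p],
        (∑ S ∈ univ.filter p, c' S) = ∑ S ∈ univ.filter (fun S => p S ∧ Disjoint B S), c S := by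
      intro p _
      rw [Finset.sum_filter, Finset.sum_filter]
      refine Finset.sum_congr rfl fun S _ => ?_
      simp only [hc']
      by_cases hp : p S <;> by_cases hd : Disjoint B S <;> simp [hp, hd]
    have dZ : (∑ S, c' S) = ∑ S ∈ univ.filter (fun S : Finset σ => Disjoint B S), c S := by
      have := dsum (fun _ => True)
      simp only [true_and] at this
      rw [Finset.filter_true_of_mem (fun _ _ => trivial)] at this
      exact this
    -- rewrite the negative-correlation inequality in terms of `c`
    rw [dsum, dsum, dsum, dZ] at hnc
    -- notation
    set Ib := ∑ S ∈ univ.filter (fun S : Finset σ => b ∈ S ∧ Disjoint B S), c S with hIb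
    set I0 := ∑ S ∈ univ.filter (fun S : Finset σ => j ∈ S ∧ Disjoint B S), c S with hI0
    set I2 := ∑ S ∈ univ.filter (fun S : Finset σ => (b ∈ S ∧ j ∈ S) ∧ Disjoint B S), c S with hI2
    set Zv := ∑ S ∈ univ.filter (fun S : Finset σ => Disjoint B S), c S with hZv
    set Z := ∑ S, c S with hZ
    set Pb := ∑ S ∈ univ.filter (fun S : Finset σ => b ∈ S), c S with hPb
    -- decompositions along `j ∈ S`
    have hsplit : ∀ (p : Finset σ → Prop) [DecidablePred p],
        (∑ S ∈ univ.filter (fun S => p S ∧ Disjoint B S), c S) =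
          (∑ S ∈ univ.filter (fun S => (p S ∧ j ∈ S) ∧ Disjoint B S), c S) +
            ∑ S ∈ univ.filter (fun S => p S ∧ Disjoint (insert j B) S), c S := by
      intro p _
      rw [← Finset.sum_filter_add_sum_filter_not (univ.filter fun S => p S ∧ Disjoint B S) (fun S => j ∈ S),
        Finset.filter_filter, Finset.filter_filter]
      congr 1
      · exact Finset.sum_congr (Finset.filter_congr fun S _ => by tauto) fun _ _ => rfl
      · refine Finset.sum_congr (Finset.filter_congr fun S _ => ?_) fun _ _ => rfl
        rw [Finset.disjoint_insert_left]
        tauto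
    have hIb_split : Ib = I2 + ∑ S ∈ univ.filter (fun S : Finset σ => b ∈ S ∧ Disjoint (insert j B) S), c S :=
      hsplit (fun S => b ∈ S)
    have hZv_split : Zv = I0 + ∑ S ∈ univ.filter (fun S : Finset σ => Disjoint (insert j B) S), c S := by
      have := hsplit (fun _ => True)
      simp only [true_and] at this
      rw [hZv, this]
    set Ib' := ∑ S ∈ univ.filter (fun S : Finset σ => b ∈ S ∧ Disjoint (insert j B) S), c S with hIb'
    set Zv' := ∑ S ∈ univ.filter (fun S : Finset σ => Disjoint (insert j B) S), c S with hZv'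
    -- signs
    have hI2 : 0 ≤ I2 := Finset.sum_nonneg fun S _ => hc0 S
    have hZv'0 : 0 ≤ Zv' := Finset.sum_nonneg fun S _ => hc0 S
    have hIb'0 : 0 ≤ Ib' := Finset.sum_nonneg fun S _ => hc0 S
    have hI00 : 0 ≤ I0 := Finset.sum_nonneg fun S _ => hc0 S
    have hPb0 : 0 ≤ Pb := Finset.sum_nonneg fun S _ => hc0 S
    have hZ0 : 0 ≤ Z := Finset.sum_nonneg fun S _ => hc0 S
    -- goal: Pb * Zv' ≤ Ib' * Z.  From hnc: I2 * Zv ≤ Ib * I0, and ih': Pb * Zv ≤ Ib * Z.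
    rw [hIb_split] at hnc ih'
    rw [hZv_split] at hnc ih'
    show Pb * Zv' ≤ Ib' * Z
    -- case analysis on Zv = I0 + Zv'
    by_cases hZv0 : I0 + Zv' = 0
    · have h1 : I0 = 0 := by linarith
      have h2 : Zv' = 0 := by linarith
      rw [h2, mul_zero]
      exact mul_nonneg hIb'0 hZ0
    · have hZvpos : 0 < I0 + Zv' := lt_of_le_of_ne (by linarith) (Ne.symm hZv0)
      -- from hnc: (I2 + Ib') * I0 ≥ I2 * (I0 + Zv')  ⇒  Ib' * I0 ≥ I2 * Zv'
      have hA : I2 * Zv' ≤ Ib' * I0 := by nlinarith [hnc]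
      -- from ih': Pb * (I0 + Zv') ≤ (I2 + Ib') * Z
      -- want Pb * Zv' ≤ Ib' * Z; multiply by (I0 + Zv') > 0
      have key : Pb * Zv' * (I0 + Zv') ≤ Ib' * Z * (I0 + Zv') := by
        have e1 : Pb * Zv' * (I0 + Zv') = (Pb * (I0 + Zv')) * Zv' := by ring
        rw [e1]
        calc (Pb * (I0 + Zv')) * Zv' ≤ ((I2 + Ib') * Z) * Zv' :=
              mul_le_mul_of_nonneg_right ih' hZv'0
          _ = I2 * Zv' * Z + Ib' * Z * Zv' := by ring
          _ ≤ Ib' * I0 * Z + Ib' * Z * Zv' := by nlinarith [mul_le_mul_of_nonneg_right hA hZ0]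
          _ = Ib' * Z * (I0 + Zv') := by ring
      exact le_of_mul_le_mul_right key hZvpos

/-- **Void probabilities are at most the product of the marginal void probabilities** (the
classical consequence of negative association for decreasing events, here from pairwise negative
correlation and conditioning only): for a nonnegative real family `c` with total mass `Σ c > 0`
that is zero-free on `H^σ` (or vanishes), and every finite `B`,
`P(S ∩ B = ∅) ≤ ∏_{b ∈ B} (1 - P(b ∈ S))`. [cite: BorceaBrandenLiggett2007, §4.1] -/
theorem multiAffine_void_le_prod (c : Finset σ → ℝ) (hc0 : ∀ S, 0 ≤ c S)
    (hc : (∀ S, c S = 0) ∨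
      ∀ z : σ → ℂ, (∀ i, 0 < (z i).im) → (∑ S : Finset σ, (c S : ℂ) * ∏ i ∈ S, z i) ≠ 0)
    (hZ : 0 < ∑ S, c S) (B : Finset σ) :
    (∑ S ∈ univ.filter (fun S : Finset σ => Disjoint B S), c S) / (∑ S, c S) ≤
      ∏ b ∈ B, (1 - (∑ S ∈ univ.filter (fun S : Finset σ => b ∈ S), c S) / (∑ S, c S)) := by
  classical
  induction B using Finset.induction_on with
  | empty =>
    simp only [Finset.disjoint_empty_left, Finset.prod_empty]
    rw [Finset.filter_true_of_mem (fun _ _ => trivial), div_self hZ.ne']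
  | insert j B hjB ih =>
    set Z := ∑ S, c S with hZdef
    have hmono := multiAffine_inclusion_mono_void c hc0 hc B hjB
    -- split the void mass of `B` along `j ∈ S`
    have hsplit : (∑ S ∈ univ.filter (fun S : Finset σ => Disjoint B S), c S) =
        (∑ S ∈ univ.filter (fun S : Finset σ => j ∈ S ∧ Disjoint B S), c S) +
          ∑ S ∈ univ.filter (fun S : Finset σ => Disjoint (insert j B) S), c S := by
      rw [← Finset.sum_filter_add_sum_filter_not (univ.filter fun S : Finset σ => Disjoint B S)
        (fun S => j ∈ S), Finset.filter_filter, Finset.filter_filter]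
      congr 1
      · exact Finset.sum_congr (Finset.filter_congr fun S _ => by tauto) fun _ _ => rfl
      · refine Finset.sum_congr (Finset.filter_congr fun S _ => ?_) fun _ _ => rfl
        rw [Finset.disjoint_insert_left]
        tauto
    set Zv := ∑ S ∈ univ.filter (fun S : Finset σ => Disjoint B S), c S with hZv
    set I0 := ∑ S ∈ univ.filter (fun S : Finset σ => j ∈ S ∧ Disjoint B S), c S with hI0
    set Zv' := ∑ S ∈ univ.filter (fun S : Finset σ => Disjoint (insert j B) S), c S with hZv'
    set Pj := ∑ S ∈ univ.filter (fun S : Finset σ => j ∈ S), c S with hPj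
    have hPjZ : Pj ≤ Z := by
      rw [hPj, hZdef, ← Finset.sum_filter_add_sum_filter_not univ (fun S : Finset σ => j ∈ S)]
      linarith [Finset.sum_nonneg (s := univ.filter fun S : Finset σ => ¬ j ∈ S) fun S _ => hc0 S]
    have hfac : 0 ≤ 1 - Pj / Z := by
      rw [sub_nonneg, div_le_one hZ]
      exact hPjZ
    -- Zv' ≤ Zv * (1 - Pj/Z)
    have hstep : Zv' ≤ Zv * (1 - Pj / Z) := by
      have h1 : Zv' = Zv - I0 := by linarith [hsplit]
      have hmono' : Pj * Zv ≤ I0 * Z := by rw [hZdef]; exact hmono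
      have h2 : Pj * Zv / Z ≤ I0 := by
        rw [div_le_iff₀ hZ]
        linarith [hmono']
      rw [h1, mul_sub, mul_one, mul_div_assoc']
      linarith [h2, show Zv * Pj / Z = Pj * Zv / Z by ring]
    rw [Finset.prod_insert hjB]
    calc Zv' / Z ≤ Zv * (1 - Pj / Z) / Z := div_le_div_of_nonneg_right hstep hZ.le
      _ = (Zv / Z) * (1 - Pj / Z) := by ring
      _ ≤ (∏ b ∈ B, (1 - (∑ S ∈ univ.filter (fun S : Finset σ => b ∈ S), c S) / Z)) * (1 - Pj / Z) :=
          mul_le_mul_of_nonneg_right ih hfac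
      _ = (1 - Pj / Z) * ∏ b ∈ B, (1 - (∑ S ∈ univ.filter (fun S : Finset σ => b ∈ S), c S) / Z) := by
          ring

/-- **Exponential void bound**: under the same hypotheses,
`P(S ∩ B = ∅) ≤ exp(- Σ_{b ∈ B} P(b ∈ S))` (the expected number of points in `B`), from
`1 - t ≤ e^{-t}`. [cite: BorceaBrandenLiggett2007, §4.1] -/
theorem multiAffine_void_le_exp (c : Finset σ → ℝ) (hc0 : ∀ S, 0 ≤ c S)
    (hc : (∀ S, c S = 0) ∨
      ∀ z : σ → ℂ, (∀ i, 0 < (z i).im) → (∑ S : Finset σ, (c S : ℂ) * ∏ i ∈ S, z i) ≠ 0)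
    (hZ : 0 < ∑ S, c S) (B : Finset σ) :
    (∑ S ∈ univ.filter (fun S : Finset σ => Disjoint B S), c S) / (∑ S, c S) ≤
      Real.exp (-(∑ b ∈ B, (∑ S ∈ univ.filter (fun S : Finset σ => b ∈ S), c S) / (∑ S, c S))) := by
  classical
  refine (multiAffine_void_le_prod c hc0 hc hZ B).trans ?_
  rw [← Finset.sum_neg_distrib, Real.exp_sum]
  refine Finset.prod_le_prod (fun b _ => ?_) (fun b _ => ?_)
  · rw [sub_nonneg, div_le_one hZ, ← Finset.sum_filter_add_sum_filter_not univ (fun S : Finset σ => b ∈ S)]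
    linarith [Finset.sum_nonneg (s := univ.filter fun S : Finset σ => ¬ b ∈ S) fun S _ => hc0 S]
  · linarith [Real.add_one_le_exp (-((∑ S ∈ univ.filter (fun S : Finset σ => b ∈ S), c S) / ∑ S, c S))]

end Literature.Combinatorics.StablePolynomials

end
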